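import Mathlib
import Literature.Computability.AlgebraicComplexity.StandardFamilies
import Summits.ValiantsHypothesis.ValiantsHypothesis.Theses.RefutationDegree
import Summits.ValiantsHypothesis.ValiantsHypothesis.Theorems.RefutationDegreeDefs

/-!
# Crux `RefutationBarrier` (stmt-ValiantsHypothesis-5642), line `Sketch-ideator1`: pencil coefficient facts

Helper file of the line (lead prover-line-stmt-ValiantsHypothesis-5642-0), shared by stub T1
(`stub_notHasSosRef_of_contactSeq`, arcs kill bounded-degree SOS) and the degree-grading lemma:

* `isHomogeneous_coeff_det_pencil` — every `x`-coefficient `F_μ` of `det A(x)`, `A(x) = A₀ + Σ_e x_e A_e`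
  the generic size-`m` affine pencil, is a FORM of degree `m` in the unknown entries (Leibniz expansion:
  each term is a signed product of `m` coefficientwise-linear entries);
* `coeff_defect` — the equations of Rep(n,m) are `P.coeff μ = F_μ − C c_μ` (`c_μ` = coefficient of the
  permanent), and `le_totalDegree_coeff_defect` — `F_μ ≠ 0 ⇒ deg (P.coeff μ) ≥ m`;
* `eval_cj`, `eval_mul_cj` — at a conjugate point `(a, ā)` the conjugation `cj` of the Hermitian-SOS
  format acts as complex conjugation, so a Hermitian square evaluates to `|q(a,ā)|² ≥ 0`;
* `norm_eval_le` — polynomial growth `|p(v)| ≤ ‖p‖₁ (1 + ‖v‖)^{deg p}` in the sup norm.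

Vocabulary (`Unk pencil defect eqn cj`) from `Theorems/RefutationDegreeDefs.lean`.  All folklore.
-/

-- `Summit.ValiantsHypothesis.ValiantsHypothesis.…` is the tree's mandated single-conjunct layout
-- (Sub = Summit), so the duplicated namespace component is intended.
set_option linter.dupNamespace false

noncomputable section

namespace Summit.ValiantsHypothesis.ValiantsHypothesis.Theorems.RefutationDegree

open scoped BigOperators
open Filter Topology MvPolynomial
open Literature.Computability.AlgebraicComplexity (perPoly)
open Summit.ValiantsHypothesis.ValiantsHypothesis.Theses.RefutationDegree

/-! ## Pencil coefficient facts (helper file `RefutationDegreeRefutationBarrierPencilCoeff.lean`)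

Purely algebraic/analytic facts about the generic pencil shared by stub T1 (arcs kill SOS) and the
degree-grading lemma: every `x`-coefficient `F_μ` of `det A(x)` is a form of degree `m` in the unknowns;
`P.coeff μ = F_μ − C c_μ`; evaluation of `cj p` at a conjugate point is the conjugate; a polynomial of
total degree `d` grows at most like `(1 + ‖v‖)^d` in the sup norm. -/

section CoeffHomogeneity

variable {n m : ℕ}

/-- Coefficientwise homogeneity is preserved by products: if all `x`-coefficients of `p` (resp. `q`)
are forms of degree `a` (resp. `b`) in the unknowns, those of `p * q` are forms of degree `a + b`.
[folklore] -/
theorem isHomogeneous_coeff_mul {a b : ℕ}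
    {p q : MvPolynomial (Fin n × Fin n) (MvPolynomial (Unk n m) ℂ)}
    (hp : ∀ μ, (p.coeff μ).IsHomogeneous a) (hq : ∀ μ, (q.coeff μ).IsHomogeneous b) :
    ∀ μ, ((p * q).coeff μ).IsHomogeneous (a + b) := by
  intro μ
  rw [MvPolynomial.coeff_mul]
  exact IsHomogeneous.sum _ _ _ fun x _ => (hp x.1).mul (hq x.2)

/-- Coefficientwise homogeneity of a finite product of coefficientwise-linear polynomials: the
`x`-coefficients of `∏_{i ∈ s} f i` are forms of degree `#s`. [folklore] -/
theorem isHomogeneous_coeff_prod {ι : Type*} [DecidableEq ι] (s : Finset ι)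
    (f : ι → MvPolynomial (Fin n × Fin n) (MvPolynomial (Unk n m) ℂ))
    (hf : ∀ i ∈ s, ∀ μ, ((f i).coeff μ).IsHomogeneous 1) :
    ∀ μ, ((∏ i ∈ s, f i).coeff μ).IsHomogeneous s.card := by
  induction s using Finset.induction_on with
  | empty =>
      intro μ
      simp only [Finset.prod_empty, Finset.card_empty, MvPolynomial.coeff_one]
      split_ifs
      · exact isHomogeneous_one _ _
      · exact isHomogeneous_zero _ _ _
  | insert a s ha ih =>
      intro μ
      rw [Finset.prod_insert ha, Finset.card_insert_of_notMem ha, add_comm]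
      exact isHomogeneous_coeff_mul (hf a (Finset.mem_insert_self a s))
        (ih fun i hi => hf i (Finset.mem_insert_of_mem hi)) μ

/-- The entries of the generic pencil are coefficientwise LINEAR in the unknowns: the constant
`x`-coefficient of `A(x)_{ij}` is the unknown `(A₀)_{ij}`, the coefficient of `x_e` is `(A_e)_{ij}`.
[folklore] -/
theorem isHomogeneous_coeff_pencil (i j : Fin m) :
    ∀ μ, ((pencil n m i j).coeff μ).IsHomogeneous 1 := by
  intro μ
  simp only [pencil, Matrix.of_apply, MvPolynomial.coeff_add, MvPolynomial.coeff_C,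
    MvPolynomial.coeff_sum]
  refine IsHomogeneous.add ?_ (IsHomogeneous.sum _ _ _ fun e _ => ?_)
  · split_ifs
    · exact isHomogeneous_X _ _
    · exact isHomogeneous_zero _ _ _
  · rw [mul_comm, MvPolynomial.coeff_C_mul, MvPolynomial.coeff_X]
    split_ifs
    · rw [mul_one]; exact isHomogeneous_X _ _
    · rw [mul_zero]; exact isHomogeneous_zero _ _ _

/-- **Every `x`-coefficient `F_μ` of `det A(x)` is a form of degree `m` in the unknowns** (each term of
the Leibniz expansion is a signed product of `m` coefficientwise-linear entries). [folklore] -/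
theorem isHomogeneous_coeff_det_pencil (n m : ℕ) (μ : (Fin n × Fin n) →₀ ℕ) :
    (((pencil n m).det).coeff μ).IsHomogeneous m := by
  classical
  rw [Matrix.det_apply', MvPolynomial.coeff_sum]
  refine IsHomogeneous.sum _ _ _ fun σ _ => ?_
  have hprod : ∀ ν, ((∏ i, pencil n m (σ i) i).coeff ν).IsHomogeneous m := by
    have h := isHomogeneous_coeff_prod (Finset.univ : Finset (Fin m))
      (fun i => pencil n m (σ i) i) (fun i _ => isHomogeneous_coeff_pencil (σ i) i)
    simpa only [Finset.card_univ, Fintype.card_fin] using h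
  -- the sign is an integer scalar `C (C k)`; stated for a generic `P` to keep rewriting away from
  -- matrix entries
  have hε : ∀ (k : ℤ) (P : MvPolynomial (Fin n × Fin n) (MvPolynomial (Unk n m) ℂ)),
      (∀ ν, (P.coeff ν).IsHomogeneous m) →
        ((((k : MvPolynomial (Fin n × Fin n) (MvPolynomial (Unk n m) ℂ))) * P).coeff μ).IsHomogeneous
          m := by
    intro k P hP
    have hcast : (k : MvPolynomial (Fin n × Fin n) (MvPolynomial (Unk n m) ℂ))
        = MvPolynomial.C (MvPolynomial.C (k : ℂ)) := by
      simp only [map_intCast]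
    rw [hcast, MvPolynomial.coeff_C_mul]
    exact (hP μ).C_mul _
  exact hε _ _ hprod

/-- The equations of Rep(n,m): `P.coeff μ = F_μ − C c_μ` with `F_μ` the `x^μ`-coefficient of
`det A(x)` and `c_μ` the `x^μ`-coefficient of `per_n` (a constant). [folklore] -/
theorem coeff_defect (n m : ℕ) (μ : (Fin n × Fin n) →₀ ℕ) :
    (defect n m).coeff μ =
      ((pencil n m).det).coeff μ - MvPolynomial.C (MvPolynomial.coeff μ (perPoly (Fin n) ℂ)) := by
  simp only [defect, MvPolynomial.coeff_sub, MvPolynomial.coeff_map]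

/-- Degree dichotomy for the equations: either `F_μ = 0` (then `P.coeff μ` is the constant `−c_μ`) or
`P.coeff μ` has total degree `≥ m`. [folklore] -/
theorem le_totalDegree_coeff_defect (n m : ℕ) (μ : (Fin n × Fin n) →₀ ℕ)
    (hF : ((pencil n m).det).coeff μ ≠ 0) : m ≤ ((defect n m).coeff μ).totalDegree := by
  classical
  rcases Nat.eq_zero_or_pos m with hm | hm
  · simp only [hm, zero_le]
  -- a monomial `d` of `F_μ` has degree `m ≥ 1`, hence `d ≠ 0`, hence survives in `F_μ − C c_μ`
  obtain ⟨d, hd⟩ := MvPolynomial.ne_zero_iff.mp hF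
  have hdeg : m = ∑ i ∈ d.support, d i :=
    (isHomogeneous_coeff_det_pencil n m μ).degree_eq_sum_deg_support
      (MvPolynomial.mem_support_iff.mpr hd)
  have hd0 : d ≠ 0 := by
    rintro rfl
    simp only [Finsupp.support_zero, Finset.sum_empty] at hdeg
    omega
  have hcoeff : ((defect n m).coeff μ).coeff d = ((pencil n m).det.coeff μ).coeff d := by
    rw [coeff_defect, MvPolynomial.coeff_sub, MvPolynomial.coeff_C, if_neg (Ne.symm hd0), sub_zero]
  have hmem : d ∈ ((defect n m).coeff μ).support := by
    rw [MvPolynomial.mem_support_iff, hcoeff]; exact hd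
  calc m = ∑ i ∈ d.support, d i := hdeg
    _ = d.sum fun _ e => e := rfl
    _ ≤ ((defect n m).coeff μ).totalDegree := MvPolynomial.le_totalDegree hmem

end CoeffHomogeneity

section Conjugation

/-- At a CONJUGATE point `(a, ā)` the conjugation `cj` acts as complex conjugation of the value:
`(cj p)(a, ā) = conj (p(a, ā))`. [folklore] -/
theorem eval_cj {σ : Type*} (v : σ ⊕ σ → ℂ)
    (hv : ∀ u, v (Sum.inr u) = (starRingEnd ℂ) (v (Sum.inl u))) (p : MvPolynomial (σ ⊕ σ) ℂ) :
    MvPolynomial.eval v (cj σ p) = (starRingEnd ℂ) (MvPolynomial.eval v p) := by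
  have hswap : v ∘ Sum.swap = (starRingEnd ℂ) ∘ v := by
    funext u
    rcases u with u | u
    · simp only [Function.comp_apply, Sum.swap_inl, hv]
    · simp only [Function.comp_apply, Sum.swap_inr, hv, Complex.conj_conj]
  have h2 : (starRingEnd ℂ) (MvPolynomial.eval v p)
      = MvPolynomial.eval₂ (starRingEnd ℂ) ((starRingEnd ℂ) ∘ v) p := by
    rw [show MvPolynomial.eval v p = MvPolynomial.eval₂ (RingHom.id ℂ) v p from rfl,
      MvPolynomial.eval₂_comp_left, RingHom.comp_id]
  unfold cj
  rw [MvPolynomial.eval_rename, MvPolynomial.eval_map, hswap, h2]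

/-- The value of a Hermitian square `q · cj q` at a conjugate point is `|q(a,ā)|² ≥ 0`. [folklore] -/
theorem eval_mul_cj {σ : Type*} (v : σ ⊕ σ → ℂ)
    (hv : ∀ u, v (Sum.inr u) = (starRingEnd ℂ) (v (Sum.inl u))) (q : MvPolynomial (σ ⊕ σ) ℂ) :
    MvPolynomial.eval v (q * cj σ q) = (Complex.normSq (MvPolynomial.eval v q) : ℂ) := by
  rw [map_mul, eval_cj v hv, Complex.mul_conj]

end Conjugation

section Growth

/-- POLYNOMIAL GROWTH in the sup norm: `|p(v)| ≤ ‖p‖₁ · (1 + ‖v‖)^{deg p}` for a complex polynomial in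
finitely many variables (`‖p‖₁` = sum of the absolute values of the coefficients). [folklore] -/
theorem norm_eval_le {σ : Type*} [Fintype σ] (p : MvPolynomial σ ℂ) (v : σ → ℂ) :
    ‖MvPolynomial.eval v p‖ ≤
      (∑ α ∈ p.support, ‖MvPolynomial.coeff α p‖) * (1 + ‖v‖) ^ p.totalDegree := by
  classical
  rw [MvPolynomial.eval_eq, Finset.sum_mul]
  refine (norm_sum_le _ _).trans (Finset.sum_le_sum fun α hα => ?_)
  rw [norm_mul, norm_prod]
  refine mul_le_mul_of_nonneg_left ?_ (norm_nonneg _)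
  have h1 : ∀ i ∈ α.support, ‖v i ^ α i‖ ≤ (1 + ‖v‖) ^ α i := fun i _ => by
    rw [norm_pow]
    exact pow_le_pow_left₀ (norm_nonneg _)
      ((norm_le_pi_norm v i).trans (le_add_of_nonneg_left zero_le_one)) _
  calc ∏ i ∈ α.support, ‖v i ^ α i‖
      ≤ ∏ i ∈ α.support, (1 + ‖v‖) ^ α i :=
        Finset.prod_le_prod (fun i _ => norm_nonneg _) h1
    _ = (1 + ‖v‖) ^ (∑ i ∈ α.support, α i) := Finset.prod_pow_eq_pow_sum _ _ _
    _ ≤ (1 + ‖v‖) ^ p.totalDegree := by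
        refine pow_le_pow_right₀ (le_add_of_nonneg_right (norm_nonneg _)) ?_
        exact MvPolynomial.le_totalDegree hα

end Growth

end Summit.ValiantsHypothesis.ValiantsHypothesis.Theorems.RefutationDegree

end
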